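import Literature.Probability.NegativeDependence.NegativeAssociationProducts
import Literature.Probability.NegativeDependence.NegativeAssociationMonotoneImages
import HarnessLib

/-!
# Balls and bins: the indicator variables are negatively associated (Dubhashi–Ranjan, Prop. 11)

D. Dubhashi, D. Ranjan, *Balls and bins: a study in negative dependence*, Random Struct. Algorithms 13 (1998)
99–124 (held `paper:doi-10-1002-sici-1098-2418-199809-13-2-99-aid-rsa1-3-0-co-2-m`).

§1 (p. 2): "Suppose we throw `m` balls into `n` bins independently at random. […] in the general case, one
can have an arbitrary set of probabilities for each ball: the probability that ball `k` goes into bin `i` is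
`p_{i,k}`". §3.1 (p. 7): `B_{i,k}` is the indicator of "ball `k` goes into bin `i`", and verbatim:

> For any fixed `k ∈ [m]`, take `X_i := B_{i,k}`, `i ∈ [n]` and use the Zero–One lemma to conclude that the
> indicator variables `(B_{i,k}, i ∈ [n])` for any fixed `k ∈ [m]` satisfy (−A). Since the balls are thrown
> independently of each other, we obtain immediately from Proposition 7 the following consequence:
> **Proposition 11** The full vector `(B_{i,j}, i ∈ [n], j ∈ [m])` is negatively associated.

## Formalization (the tree's 0/1 framework: weights on `2^E`, NA = `IsNegAssoc`)

The ground set is `σ × κ` (bins `σ`, balls `κ`); a configuration is the set `U ⊆ σ × κ` of pairs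
(bin of ball `k`, `k`), so `B_{i,k} = 𝟏[(i,k) ∈ U]`, and the joint law of the indicator vector is the weight
`ballsBins p (U) = 𝟏[every ball lies in exactly one bin] · ∏_{(i,k) ∈ U} p_{i,k}` (normalization
`Σ_i p_{i,k} = 1` is not needed for NA and not assumed).

* §1 `IsNegAssoc.comap_equiv`: NA is transported along a relabelling `α ≃ β` of the ground set (plumbing for
  the induction on the number of balls).
* §2 one ball: `oneBall q` (the law of `(B_{i,k})_i` for a single ball), NA by the Zero–One Lemma
  (tree: `isNegAssoc_of_card_le_one` = [DR, Lemma 8]).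
* §3 `ballsBins`, the splitting `σ × Option κ ≃ (σ × κ) ⊕ σ` of the last ball (`ballsBins_option`:
  the law of `m + 1` independent balls is the product weight `prodWeight` of the first `m` and the last one),
  and **`isNegAssoc_ballsBins`** (Prop. 11) by induction on the (finite) type of balls, each step being
  Proposition 7 (1) (tree: `IsNegAssoc.prod`).
* §4 occupancy numbers `B_i = Σ_k B_{i,k}` (`occupancy`), the increasing events `{B_i ≥ t}` (`occupancyGe`)
  depending on the pairwise disjoint blocks `binBlock i = {i} × κ`, and **`isNegAssoc_occupancyGe`**: the
  indicator vector `(𝟏[B_i ≥ t_i])_i` is NA — Theorem 13 ("`B` is negatively associated: apply Proposition 11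
  and Proposition 7 (2) together with the non-decreasing functions `B_i = Σ_j B_{i,j}`") in the 0/1 form the
  tree's framework expresses, i.e. its consequence (−OD) of Remark 15; via the tree's `IsNegAssoc.eventImage`
  (= Prop. 7 (2), indicator case). `-- TODO(general form)`: NA of the integer vector `(B_i)_i` itself.

## References

* [DubhashiRanjan1998] D. Dubhashi, D. Ranjan, Balls and bins: a study in negative dependence, Random Struct.
  Algorithms 13 (1998) — §1, §3.1 Prop. 11 (with Lemma 8 and Prop. 7 (1)), Thm. 13, Remark 15.
* [JoagDevProschan1983] K. Joag-Dev, F. Proschan, Negative association of random variables with applications,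
  Ann. Statist. 11 (1983) — §3.1(a) (multinomial), cf. [DR, Remark 14].
-/

noncomputable section

open Finset
open Literature.Combinatorics.Sahi2008

universe u

namespace Literature.Probability.NegativeDependence

/-! ## §1 Relabelling the ground set -/

section Transport

variable {α β : Type u} [Fintype α] [DecidableEq α] [Fintype β] [DecidableEq β]

/-- **NA is invariant under relabelling the coordinates**: if `ν` on `2^β` is NA and `e : α ≃ β`, then
`S ↦ ν(e[S])` on `2^α` is NA. [cite: DubhashiRanjan1998, §2.1 Def. 3 (the definition only sees disjoint index
sets and monotone functions)] -/
theorem IsNegAssoc.comap_equiv (e : α ≃ β) {ν : Finset β → ℝ} (hν : IsNegAssoc ν) :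
    IsNegAssoc (fun S : Finset α => ν (S.map e.toEmbedding)) := by
  intro F G hF hG E₁ E₂ hFE hGE hdisj
  have hback : ∀ S : Finset α, (S.map e.toEmbedding).map e.symm.toEmbedding = S := fun S => by
    ext x
    simp only [Finset.mem_map_equiv, Equiv.symm_symm, Equiv.symm_apply_apply]
  have hex : ∀ H : Finset α → ℝ, ex (fun S : Finset α => ν (S.map e.toEmbedding)) H =
      ex ν (fun T => H (T.map e.symm.toEmbedding)) := by
    intro H
    rw [ex_def, ex_def]
    refine Fintype.sum_equiv e.finsetCongr _ _ fun S => ?_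
    rw [Equiv.finsetCongr_apply, hback]
  have hmass : mass (fun S : Finset α => ν (S.map e.toEmbedding)) = mass ν := by
    have h := hex fun _ => 1
    simp only [ex_def, mul_one] at h
    rw [mass_def, mass_def, h]
  have hmono : ∀ H : Finset α → ℝ, Monotone H → Monotone fun T : Finset β => H (T.map e.symm.toEmbedding) :=
    fun H hH T T' hTT' => hH (Finset.map_subset_map.2 hTT')
  have hdet : ∀ (H : Finset α → ℝ) (E : Finset α), DeterminedBy H E →
      DeterminedBy (fun T : Finset β => H (T.map e.symm.toEmbedding)) (E.map e.toEmbedding) := by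
    intro H E hHE T T' hTT'
    have key := congrArg (Finset.map e.symm.toEmbedding) hTT'
    rw [Finset.map_inter, Finset.map_inter, hback] at key
    exact hHE _ _ key
  rw [hex, hex, hex, hmass]
  exact hν (F := fun T => F (T.map e.symm.toEmbedding)) (G := fun T => G (T.map e.symm.toEmbedding))
    (hmono F hF) (hmono G hG) (hdet F E₁ hFE) (hdet G E₂ hGE) ((Finset.disjoint_map _).2 hdisj)

end Transport

variable {σ : Type u} [Fintype σ] [DecidableEq σ]

/-! ## §2 One ball -/

section OneBall

/-- **One ball**: the (unnormalized) law on `2^σ` of the indicator vector `(B_i)_{i ∈ σ}` of a single ball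
landing in bin `i` with weight `q_i` — supported on singletons, `{i} ↦ q_i`. [cite: DubhashiRanjan1998, §3.1
(proof of Prop. 11: "for any fixed `k`, take `X_i := B_{i,k}`")] -/
def oneBall (q : σ → ℝ) : Finset σ → ℝ := fun T => (if T.card = 1 then 1 else 0) * ∏ i ∈ T, q i

omit [Fintype σ] [DecidableEq σ] in
/-- Unfolding `oneBall`. [cite: DubhashiRanjan1998, §3.1] -/
theorem oneBall_apply (q : σ → ℝ) (T : Finset σ) :
    oneBall q T = (if T.card = 1 then 1 else 0) * ∏ i ∈ T, q i := rfl

omit [Fintype σ] [DecidableEq σ] in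
/-- `oneBall q {i} = q i`. [cite: DubhashiRanjan1998, §3.1] -/
theorem oneBall_singleton (q : σ → ℝ) (i : σ) : oneBall q {i} = q i := by
  rw [oneBall_apply, Finset.card_singleton, if_pos rfl, one_mul, Finset.prod_singleton]

omit [Fintype σ] [DecidableEq σ] in
/-- `oneBall q ≥ 0` for `q ≥ 0`. [cite: DubhashiRanjan1998, §3.1] -/
theorem oneBall_nonneg {q : σ → ℝ} (hq : ∀ i, 0 ≤ q i) (T : Finset σ) : 0 ≤ oneBall q T :=
  mul_nonneg (by split_ifs <;> norm_num) (Finset.prod_nonneg fun i _ => hq i)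

/-- **Zero–One Lemma for one ball**: `(B_{i,k})_{i}` for fixed `k` is NA. [cite: DubhashiRanjan1998, §3.1
(proof of Prop. 11), Lemma 8] -/
theorem isNegAssoc_oneBall {q : σ → ℝ} (hq : ∀ i, 0 ≤ q i) : IsNegAssoc (oneBall q) :=
  isNegAssoc_of_card_le_one (oneBall_nonneg hq) fun T hT => by
    by_contra h
    apply hT
    rw [oneBall_apply, if_neg (by omega), zero_mul]

/-- One ball is even CNA+. [cite: DubhashiRanjan1998, §3.1, Lemma 8; BorceaBrandenLiggett2007, §2.1
Def. 2.7] -/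
theorem isCNAPlus_oneBall {q : σ → ℝ} (hq : ∀ i, 0 ≤ q i) : IsCNAPlus (oneBall q) :=
  isCNAPlus_of_card_le_one (oneBall_nonneg hq) fun T hT => by
    by_contra h
    apply hT
    rw [oneBall_apply, if_neg (by omega), zero_mul]

end OneBall

/-! ## §3 Balls and bins -/

section BallsBins

variable {κ : Type u} [Fintype κ] [DecidableEq κ]

/-- `𝟏[every ball lies in exactly one bin]` for a configuration `U ⊆ σ × κ` of (bin, ball) pairs.
[cite: DubhashiRanjan1998, §1 (the balls and bins experiment), §3.1] -/
def ballInd (U : Finset (σ × κ)) : ℝ :=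
  ∏ k : κ, if (Finset.univ.filter fun i : σ => (i, k) ∈ U).card = 1 then (1 : ℝ) else 0

/-- **Balls and bins**: the (unnormalized) joint law on `2^{σ × κ}` of the indicator variables
`B_{i,k} = 𝟏[ball k goes into bin i]` when the balls are thrown independently, ball `k` into bin `i` with
weight `p_{i,k}`: `U ↦ 𝟏[U is the graph of an assignment balls → bins] · ∏_{(i,k) ∈ U} p_{i,k}`.
[cite: DubhashiRanjan1998, §1 ("the probability that ball `k` goes into bin `i` is `p_{i,k}`"), §3.1] -/
def ballsBins (p : σ → κ → ℝ) : Finset (σ × κ) → ℝ := fun U => ballInd U * ∏ x ∈ U, p x.1 x.2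

/-- Unfolding `ballsBins`. [cite: DubhashiRanjan1998, §3.1] -/
theorem ballsBins_apply (p : σ → κ → ℝ) (U : Finset (σ × κ)) :
    ballsBins p U = ballInd U * ∏ x ∈ U, p x.1 x.2 := rfl

/-- `ballInd ∈ {0, 1}`, in particular `≥ 0`. [cite: DubhashiRanjan1998, §3.1] -/
theorem ballInd_nonneg (U : Finset (σ × κ)) : 0 ≤ ballInd U :=
  Finset.prod_nonneg fun k _ => by split_ifs <;> norm_num

/-- `ballsBins p ≥ 0` for `p ≥ 0`. [cite: DubhashiRanjan1998, §3.1] -/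
theorem ballsBins_nonneg {p : σ → κ → ℝ} (hp : ∀ i k, 0 ≤ p i k) (U : Finset (σ × κ)) : 0 ≤ ballsBins p U :=
  mul_nonneg (ballInd_nonneg U) (Finset.prod_nonneg fun x _ => hp x.1 x.2)

/-- Relabelling the balls along `e : α ≃ β`. [cite: DubhashiRanjan1998, §3.1] -/
theorem ballsBins_comp_equiv {α β : Type u} [Fintype α] [DecidableEq α] [Fintype β] [DecidableEq β]
    (e : α ≃ β) (p : σ → β → ℝ) (U : Finset (σ × β)) :
    ballsBins p U =
      ballsBins (fun i a => p i (e a)) (U.map ((Equiv.refl σ).prodCongr e).symm.toEmbedding) := by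
  have hmem : ∀ (i : σ) (a : α), (i, a) ∈ U.map ((Equiv.refl σ).prodCongr e).symm.toEmbedding ↔
      (i, e a) ∈ U := fun i a => by
    rw [Finset.mem_map_equiv, Equiv.symm_symm, Equiv.prodCongr_apply]
    rfl
  rw [ballsBins_apply, ballsBins_apply]
  congr 1
  · rw [ballInd, ballInd, ← Equiv.prod_comp e]
    refine Fintype.prod_congr _ _ fun a => ?_
    have hfilter : (Finset.univ.filter fun i : σ => (i, e a) ∈ U) =
        Finset.univ.filter fun i : σ => (i, a) ∈ U.map ((Equiv.refl σ).prodCongr e).symm.toEmbedding :=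
      Finset.filter_congr fun i _ => (hmem i a).symm
    rw [hfilter]
  · rw [Finset.prod_map]
    refine Finset.prod_congr rfl fun x _ => ?_
    simp only [Equiv.coe_toEmbedding, Equiv.prodCongr_symm, Equiv.prodCongr_apply, Equiv.refl_symm,
      Prod.map_fst, Prod.map_snd, Equiv.coe_refl, id, Equiv.apply_symm_apply]

/-- Splitting off one ball: `σ × Option κ ≃ (σ × κ) ⊕ σ` (the last ball's bin goes to the right summand).
[cite: DubhashiRanjan1998, §3.1 (proof of Prop. 11: the balls are independent)] -/
def optionBallEquiv (σ κ : Type u) : σ × Option κ ≃ (σ × κ) ⊕ σ where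
  toFun x := match x with
    | (i, some k) => Sum.inl (i, k)
    | (i, none) => Sum.inr i
  invFun y := match y with
    | Sum.inl (i, k) => (i, some k)
    | Sum.inr i => (i, none)
  left_inv := by rintro ⟨i, _ | k⟩ <;> rfl
  right_inv := by rintro (⟨i, k⟩ | i) <;> rfl

omit [Fintype σ] [DecidableEq σ] [Fintype κ] [DecidableEq κ] in
/-- [cite: DubhashiRanjan1998, §3.1] -/
theorem optionBallEquiv_symm_inl (x : σ × κ) : (optionBallEquiv σ κ).symm (Sum.inl x) = (x.1, some x.2) :=
  rfl

omit [Fintype σ] [DecidableEq σ] [Fintype κ] [DecidableEq κ] in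
/-- [cite: DubhashiRanjan1998, §3.1] -/
theorem optionBallEquiv_symm_inr (i : σ) : (optionBallEquiv σ κ).symm (Sum.inr i) = (i, none) := rfl

/-- **Independence of the balls**: the law of the balls `Option κ` is the product (`prodWeight`) of the law of
the balls `κ` and the one-ball law of the extra ball `none`, along `optionBallEquiv`.
[cite: DubhashiRanjan1998, §3.1 (proof of Prop. 11: "Since the balls are thrown independently of each
other")] -/
theorem ballsBins_option [DecidableEq (Option κ)] (p : σ → Option κ → ℝ) (U : Finset (σ × Option κ)) :
    ballsBins p U = prodWeight (ballsBins fun i k => p i (some k)) (oneBall fun i => p i none)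
      (U.map (optionBallEquiv σ κ).toEmbedding) := by
  set V := U.map (optionBallEquiv σ κ).toEmbedding with hV
  have hL : ∀ x : σ × κ, x ∈ V.toLeft ↔ (x.1, some x.2) ∈ U := fun x => by
    rw [Finset.mem_toLeft, hV, Finset.mem_map_equiv, optionBallEquiv_symm_inl]
  have hR : ∀ i : σ, i ∈ V.toRight ↔ (i, none) ∈ U := fun i => by
    rw [Finset.mem_toRight, hV, Finset.mem_map_equiv, optionBallEquiv_symm_inr]
  have hRset : V.toRight = Finset.univ.filter fun i : σ => (i, none) ∈ U := by
    ext i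
    rw [hR, Finset.mem_filter, and_iff_right (Finset.mem_univ _)]
  -- the product of the `p`'s splits along `V = V.toLeft ⊔ V.toRight`
  have hprod : ∏ x ∈ U, p x.1 x.2 = (∏ x ∈ V.toLeft, p x.1 (some x.2)) * ∏ i ∈ V.toRight, p i none := by
    have h1 : ∏ x ∈ U, p x.1 x.2 =
        ∏ y ∈ V, p ((optionBallEquiv σ κ).symm y).1 ((optionBallEquiv σ κ).symm y).2 := by
      rw [hV, Finset.prod_map]
      refine Finset.prod_congr rfl fun x _ => ?_
      rw [Equiv.coe_toEmbedding, Equiv.symm_apply_apply]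
    rw [h1, Finset.prod_sum_eq_prod_toLeft_mul_prod_toRight]
    rfl
  -- the indicator splits likewise
  have hind : ballInd U = ballInd V.toLeft * if V.toRight.card = 1 then (1 : ℝ) else 0 := by
    rw [ballInd, Fintype.prod_option, mul_comm, hRset, ballInd]
    congr 1
    refine Fintype.prod_congr _ _ fun k => ?_
    have hfilter : (Finset.univ.filter fun i : σ => (i, some k) ∈ U) =
        Finset.univ.filter fun i : σ => (i, k) ∈ V.toLeft :=
      Finset.filter_congr fun i _ => (hL (i, k)).symm
    rw [hfilter]
  rw [prodWeight_apply, ballsBins_apply, ballsBins_apply, oneBall_apply, hind, hprod]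
  ring

/-- The induction step: if the balls `κ` give an NA law then so do the balls `Option κ` (Prop. 7 (1) applied
to the independent families "balls `κ`" and "ball `none`"). [cite: DubhashiRanjan1998, §3.1 (proof of
Prop. 11)] -/
theorem isNegAssoc_ballsBins_option [DecidableEq (Option κ)] {p : σ → Option κ → ℝ} (hp : ∀ i k, 0 ≤ p i k)
    (IH : IsNegAssoc (ballsBins fun i k => p i (some k))) : IsNegAssoc (ballsBins p) := by
  have key := (IH.prod (isNegAssoc_oneBall (q := fun i => p i none) fun i => hp i none)
    (ballsBins_nonneg fun i k => hp i (some k)) (oneBall_nonneg fun i => hp i none)).comap_equiv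
    (optionBallEquiv σ κ)
  have heq : ballsBins p = fun S : Finset (σ × Option κ) =>
      prodWeight (ballsBins fun i k => p i (some k)) (oneBall fun i => p i none)
        (S.map (optionBallEquiv σ κ).toEmbedding) :=
    funext fun U => ballsBins_option p U
  rw [heq]
  exact key

/-- **Dubhashi–Ranjan, Proposition 11: in the balls and bins experiment (independent balls, arbitrary
probabilities `p_{i,k} ≥ 0`) the full vector of indicator variables `(B_{i,k})_{i ∈ σ, k ∈ κ}` is negatively
associated.** [cite: DubhashiRanjan1998, §3.1 Prop. 11] -/
theorem isNegAssoc_ballsBins (p : σ → κ → ℝ) (hp : ∀ i k, 0 ≤ p i k) : IsNegAssoc (ballsBins p) := by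
  have main := @Fintype.induction_empty_option
    (fun (α : Type u) (_ : Fintype α) =>
      ∀ [DecidableEq α] (p : σ → α → ℝ), (∀ i k, 0 ≤ p i k) → IsNegAssoc (ballsBins p))
    ?_ ?_ ?_ κ _
  · exact main p hp
  · -- relabelling the balls
    intro α β _ e h _ p hp
    letI : Fintype α := Fintype.ofEquiv β e.symm
    letI : DecidableEq α := e.decidableEq
    have IH : IsNegAssoc (ballsBins fun i a => p i (e a)) := h (fun i a => p i (e a)) fun i a => hp i (e a)
    have key := IH.comap_equiv ((Equiv.refl σ).prodCongr e).symm
    have heq : ballsBins p = fun S : Finset (σ × β) =>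
        ballsBins (fun i a => p i (e a)) (S.map ((Equiv.refl σ).prodCongr e).symm.toEmbedding) :=
      funext fun U => ballsBins_comp_equiv e p U
    rw [heq]
    exact key
  · -- no balls: the law is the unit mass at the empty configuration
    intro _ p hp
    exact isNegAssoc_of_card_le_one (ballsBins_nonneg hp) fun U _ => by
      rw [Finset.eq_empty_of_isEmpty U, Finset.card_empty]
      exact zero_le_one
  · -- one more ball
    intro α _ h _ p hp
    letI : DecidableEq α := fun a b => decidable_of_iff (some a = some b) Option.some_inj
    exact isNegAssoc_ballsBins_option hp (h (fun i k => p i (some k)) fun i k => hp i (some k))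

/-- **Proposition 11, as printed** (probabilities: `p ≥ 0`; the normalization `Σ_i p_{i,k} = 1` plays no
role). [cite: DubhashiRanjan1998, §3.1 Prop. 11] -/
theorem DubhashiRanjan_prop_11 (p : σ → κ → ℝ) (hp : ∀ i k, 0 ≤ p i k) : IsNegAssoc (ballsBins p) :=
  isNegAssoc_ballsBins p hp

end BallsBins

/-! ## §4 Occupancy numbers -/

section Occupancy

variable {κ : Type u} [Fintype κ] [DecidableEq κ]

/-- The block of coordinates of bin `i`: `{(i, k) : k ∈ κ}`. [cite: DubhashiRanjan1998, §3.1 (proof of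
Thm. 13: `B_i` is a function of `(B_{i,j})_j`)] -/
def binBlock (i : σ) : Finset (σ × κ) := Finset.univ.filter fun x => x.1 = i

omit [DecidableEq κ] in
/-- Membership in `binBlock`. [cite: DubhashiRanjan1998, §3.1] -/
theorem mem_binBlock {i : σ} {x : σ × κ} : x ∈ (binBlock i : Finset (σ × κ)) ↔ x.1 = i := by
  rw [binBlock, Finset.mem_filter, and_iff_right (Finset.mem_univ _)]

omit [DecidableEq κ] in
/-- Distinct bins have disjoint blocks. [cite: DubhashiRanjan1998, §3.1 (proof of Thm. 13: disjoint index
sets)] -/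
theorem disjoint_binBlock {i j : σ} (h : i ≠ j) : Disjoint (binBlock i : Finset (σ × κ)) (binBlock j) :=
  Finset.disjoint_left.2 fun _ hxi hxj => h ((mem_binBlock.1 hxi).symm.trans (mem_binBlock.1 hxj))

/-- **The occupancy number** `B_i(U) = #{k : (i,k) ∈ U} = Σ_k B_{i,k}`. [cite: DubhashiRanjan1998, §1
("`B_i` the number of balls in the `i`th bin"), §3.1 Thm. 13] -/
def occupancy (U : Finset (σ × κ)) (i : σ) : ℕ := (Finset.univ.filter fun k : κ => (i, k) ∈ U).card

omit [Fintype σ] in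
/-- `B_i` is increasing in the configuration. [cite: DubhashiRanjan1998, §3.1 (proof of Thm. 13:
"non-decreasing functions `B_i`")] -/
theorem occupancy_mono {U U' : Finset (σ × κ)} (h : U ⊆ U') (i : σ) : occupancy U i ≤ occupancy U' i :=
  Finset.card_le_card fun k hk => by
    rw [Finset.mem_filter] at hk ⊢
    exact ⟨hk.1, h hk.2⟩

/-- `B_i` depends only on bin `i`'s block. [cite: DubhashiRanjan1998, §3.1 (proof of Thm. 13)] -/
theorem occupancy_eq_of_inter_binBlock {U U' : Finset (σ × κ)} (i : σ)
    (h : U ∩ binBlock i = U' ∩ binBlock i) : occupancy U i = occupancy U' i := by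
  unfold occupancy
  congr 1
  refine Finset.filter_congr fun k _ => ?_
  have hk : ((i, k) : σ × κ) ∈ (binBlock i : Finset (σ × κ)) := mem_binBlock.2 rfl
  constructor
  · intro hU
    exact (Finset.mem_inter.1 ((Finset.ext_iff.1 h (i, k)).1 (Finset.mem_inter.2 ⟨hU, hk⟩))).1
  · intro hU'
    exact (Finset.mem_inter.1 ((Finset.ext_iff.1 h (i, k)).2 (Finset.mem_inter.2 ⟨hU', hk⟩))).1

/-- **The event `{B_i ≥ t}`.** [cite: DubhashiRanjan1998, §3.1 Remark 15 (`Pr[B_i ≥ t_i, …]`)] -/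
def occupancyGe (i : σ) (t : ℕ) : Finset (Finset (σ × κ)) := Finset.univ.filter fun U => t ≤ occupancy U i

/-- Membership in `occupancyGe`. [cite: DubhashiRanjan1998, §3.1 Remark 15] -/
theorem mem_occupancyGe {i : σ} {t : ℕ} {U : Finset (σ × κ)} :
    U ∈ (occupancyGe i t : Finset (Finset (σ × κ))) ↔ t ≤ occupancy U i := by
  rw [occupancyGe, Finset.mem_filter, and_iff_right (Finset.mem_univ _)]

/-- `{B_i ≥ t}` is increasing. [cite: DubhashiRanjan1998, §3.1 (proof of Thm. 13), Remark 15] -/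
theorem isUpperSet_occupancyGe (i : σ) (t : ℕ) :
    IsUpperSet ((occupancyGe i t : Finset (Finset (σ × κ))) : Set (Finset (σ × κ))) :=
  fun U U' hUU' hU => by
    rw [Finset.mem_coe, mem_occupancyGe] at hU ⊢
    exact hU.trans (occupancy_mono hUU' i)

/-- `{B_i ≥ t}` depends only on bin `i`'s block. [cite: DubhashiRanjan1998, §3.1 (proof of Thm. 13)] -/
theorem determinedBy_occupancyGe (i : σ) (t : ℕ) :
    DeterminedBy (setInd (occupancyGe i t : Finset (Finset (σ × κ)))) (binBlock i) := fun U U' h => by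
  rw [setInd_apply, setInd_apply]
  exact if_congr (by rw [mem_occupancyGe, mem_occupancyGe, occupancy_eq_of_inter_binBlock i h]) rfl rfl

/-- **Increasing events of single bins are NA** under the balls-and-bins law: for increasing events `𝒜_i`
depending only on `binBlock i`, the indicator vector `(𝟏_{𝒜_i})_i` is NA (Prop. 11 with Prop. 7 (2)).
[cite: DubhashiRanjan1998, §3.1 Remark 12, Thm. 13 (proof)] -/
theorem isNegAssoc_eventImage_ballsBins {p : σ → κ → ℝ} (hp : ∀ i k, 0 ≤ p i k)
    {𝒜 : σ → Finset (Finset (σ × κ))} (h𝒜 : ∀ i, IsUpperSet (𝒜 i : Set (Finset (σ × κ))))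
    (hI : ∀ i, DeterminedBy (setInd (𝒜 i)) (binBlock i : Finset (σ × κ))) :
    IsNegAssoc (eventImage 𝒜 (ballsBins p)) :=
  (isNegAssoc_ballsBins p hp).eventImage h𝒜 hI fun _ _ hij => disjoint_binBlock hij

/-- **Dubhashi–Ranjan, Theorem 13 (0/1 form) / Remark 15: the threshold indicators `(𝟏[B_i ≥ t_i])_{i ∈ σ}`
of the occupancy numbers are negatively associated.** [cite: DubhashiRanjan1998, §3.1 Thm. 13, Remark 15] -/
theorem isNegAssoc_occupancyGe (p : σ → κ → ℝ) (hp : ∀ i k, 0 ≤ p i k) (t : σ → ℕ) :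
    IsNegAssoc (eventImage (fun i => (occupancyGe i (t i) : Finset (Finset (σ × κ)))) (ballsBins p)) :=
  isNegAssoc_eventImage_ballsBins hp (fun i => isUpperSet_occupancyGe i (t i))
    fun i => determinedBy_occupancyGe i (t i)

-- TODO(general form): [DR, Thm. 13] as printed — NA of the integer-valued vector `(B_i)_{i ∈ σ}` — needs NA
-- for non-binary variables, outside the tree's framework of weights on `2^E`.

end Occupancy

end Literature.Probability.NegativeDependence

end
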